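/-
Copyright (c) 2026 the pub-hodgecm-mathlib formalisation cell (harness21).  Prover seat hodgecm-mathlib-A-p03 (g24); LEAD F0P3a-plan (g9) WORD T8-81 «LAYER B_H»;
LAYER C for the `T_H` clause (values-abstract), pattern of F0P3b-p01 (g6)'s ★ `UnitOrbitalIntegralInertValuesTheta`, 2026-09-01.
-/
import Literature.NumberTheory.Rogawski1990.UnitOrbitalIntegralInertSumsTypeTwo        -- ★ B-p14: `sum_pow_mul_innerSumTen_eq_phiTHM`
import Literature.NumberTheory.Rogawski1990.UnitOrbitalIntegralInertValuesTheta        -- ★ F0P3b-p01: `finsum_iTen_eq_innerSumTen`, `iTen_eq_zero_of_lt`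
import HarnessLib

/-!
# LAYER C, `T_H` clause, values-abstract: `∑ᶠ_m ∑ᶠ_n q^n · I(n,m) = phiTHM q N₊ N` when `I(n,·)` is Prop. 10's `T_H` table for `n ≤ N` and `0` beyond

Topic `NumberTheory/Rogawski1990` (road «D-N7-inert», MAP v3 (F11) κ = +1 value); namespace `Literature.NumberTheory.Rogawski1990.Flicker1998`.  THEOREMS ONLY;
kernel lane.

Cor. 9 for the ramified torus `T_H` reads `#Fix_m = ∑ᶠ_n q^n · #(n, m)` (weight `[T_H : T_H ∩ r_n K_H r_n⁻¹] = q^n`, Prop. 6 (c)∕7), and LAYER B_H (★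
`natCard_cosets_ramifiedTorus_even∕odd_eq_iTen`, ★ `natCard_cosets_eq_zero_of_one_lt`) gives `#(n,m) = iTen q (N−n) N₊ m` (`n ≤ N`), `0` (`n > N`).  This file
does the bookkeeping to B-p14's ★ LAYER A `sum_pow_mul_innerSumTen_eq_phiTHM`: **`finsum_finsum_pow_mul_eq_phiTHM`**, plus the single-level
`finsum_pow_mul_eq_sum` and an `A : ℕ → ℕ` cast companion **`finsum_natCast_eq_phiTHM`** (the shape the `U`-level assembly consumes).
HONEST LABEL: HC_CM is proved only modulo the printed citations until rung 0 closes.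

## References
* [Flicker1998UnitaryFL] Y. Z. Flicker, *Elementary proof of the fundamental lemma for a unitary group*, Canad. J. Math. 50 (1998), 74–98: Cor. 9 p. 85, Prop. 10 p. 85,
  Prop. 11 (second half) p. 87.
-/

set_option autoImplicit false

open Finset

namespace Literature.NumberTheory.Rogawski1990

namespace Flicker1998

section ValuesTH

variable (q : ℕ) {N Np : ℕ} (I : ℕ → ℕ → ℚ)
  (hle : ∀ n m, n ≤ N → I n m = iTen q (N - n) Np m) (hbig : ∀ n m, N < n → I n m = 0)
include hle hbig

/-- One level `m`: `∑ᶠ_n q^n I(n,m) = Σ_{n ≤ N} q^n · iTen q (N−n) N₊ m`. [cite: Flicker1998UnitaryFL, Cor. 9 p. 85] -/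
theorem finsum_pow_mul_eq_sum (m : ℕ) :
    ∑ᶠ n, (q : ℚ) ^ n * I n m = ∑ n ∈ range (N + 1), (q : ℚ) ^ n * iTen q (N - n) Np m := by
  rw [finsum_eq_sum_of_support_subset (s := range (N + 1))]
  · refine sum_congr rfl fun n hn => ?_
    rw [mem_range] at hn
    rw [hle n m (by omega)]
  · intro n hn
    rw [Function.mem_support] at hn
    rw [coe_range, Set.mem_Iio]
    by_contra h
    exact hn (by rw [hbig n m (by omega), mul_zero])

/-- **`∑ᶠ_m ∑ᶠ_n q^n I(n,m) = phiTHM q N₊ N`** — Cor. 9 (ramified) summed against Prop. 10's `T_H` table is Prop. 11's second-half value in B-p14's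
`(M, N)`-indexing (`M := N₊`). [cite: Flicker1998UnitaryFL, Cor. 9 p. 85, Prop. 11 p. 87] -/
theorem finsum_finsum_pow_mul_eq_phiTHM (hq : 1 < q) : ∑ᶠ m, ∑ᶠ n, (q : ℚ) ^ n * I n m = phiTHM q Np N := by
  simp_rw [finsum_pow_mul_eq_sum q I hle hbig]
  rw [finsum_eq_sum_of_support_subset (s := range (N + 1))]
  · rw [sum_comm, ← sum_pow_mul_innerSumTen_eq_phiTHM hq Np N]
    refine sum_congr rfl fun n hn => ?_
    rw [mem_range] at hn
    rw [← mul_sum, ← finsum_iTen_eq_innerSumTen, finsum_eq_sum_of_support_subset (s := range (N + 1))]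
    intro m hm
    rw [Function.mem_support] at hm
    rw [coe_range, Set.mem_Iio]
    by_contra h
    exact hm (iTen_eq_zero_of_lt q (by omega))
  · intro m hm
    rw [Function.mem_support] at hm
    rw [coe_range, Set.mem_Iio]
    by_contra h
    refine hm (sum_eq_zero fun n hn => ?_)
    rw [iTen_eq_zero_of_lt q (by omega), mul_zero]

/-- Cast companion: if `A m : ℕ` has `(A m : ℚ) = ∑ᶠ_n q^n I(n,m)` then `∑ᶠ_m (A m : ℚ) = phiTHM q N₊ N`. [cite: Flicker1998UnitaryFL, Prop. 11 p. 87] -/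
theorem finsum_natCast_eq_phiTHM (hq : 1 < q) (A : ℕ → ℕ) (hA : ∀ m, (A m : ℚ) = ∑ᶠ n, (q : ℚ) ^ n * I n m) :
    ∑ᶠ m, (A m : ℚ) = phiTHM q Np N := by
  simp_rw [hA]
  exact finsum_finsum_pow_mul_eq_phiTHM q I hle hbig hq

end ValuesTH

end Flicker1998

end Literature.NumberTheory.Rogawski1990
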